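import Summits.BirchSwinnertonDyer.BirchSwinnertonDyer.Theses.UniversalToricDescent
import HarnessLib

/-!
# Route UniversalToricDescent — closer of the glue 27122 `DefectTransportModThreePTOfSplit`
# (`SigmaCongruenceAtThree → DefectTransportModThreePTOfSigmaCongruence → DefectTransportModThreePT`)

Prover bsd-wall-utd-p2 g12 (`--workitem stmt-BirchSwinnertonDyer-27122`; pen pss3x g4's act-F split of the
transport crux ♭T′ 26975 `DefectTransportModThreePT` (rev 45) into A = 27120 `SigmaCongruenceAtThree` (the
research content) and B″ = 27121 `DefectTransportModThreePTOfSigmaCongruence := A → ♭T′`). Modus ponens.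
THEOREM ONLY; BSD is not advanced by this file.
-/

set_option autoImplicit false
-- `…BirchSwinnertonDyer.BirchSwinnertonDyer.Theorems…` is the problem's mandated namespace (D-0017).
set_option linter.dupNamespace false

namespace Summit.BirchSwinnertonDyer.BirchSwinnertonDyer.Theorems

/-- **Item 27122 holds** (glue: `A → (A → ♭T′) → ♭T′`). [folklore] -/
theorem defectTransportModThreePTOfSplit_proof :
    Summit.BirchSwinnertonDyer.BirchSwinnertonDyer.Theses.UniversalToricDescent.DefectTransportModThreePTOfSplit :=
  fun hA hB => hB hA

end Summit.BirchSwinnertonDyer.BirchSwinnertonDyer.Theorems
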